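import Literature.Geometry.Lorentzian.KerrDataSchwarzschildExtrinsic
import Literature.Geometry.Lorentzian.SchwarzschildKerrSchildComponents
import Literature.Geometry.Lorentzian.KerrHyperboloidalLeaves
import Literature.Geometry.Lorentzian.ChartSecondFundamentalForm
import HarnessLib

/-!
# `KerrShieldedDataExist`, line `plug-the-second-sheet` — the bridge annulus, I: radial maps into the
# Schwarzschild Kerr–Schild chart

Support file (everything proved; no definitions, no named facts) for stub `stub_bridgeAnnulus` of crux
`stmt-FinalStateConjecture-10055`. The bridge datum is induced by ONE spherically symmetric immersion
`Φ(y) = τ(|y|) ∂_{t*} + (ϱ(|y|)/|y|) (0, y)` of an annulus of `E3` into the ingoing Schwarzschild chart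
`(Kerr.region 0 r₀, g_{M,0})`, `g = η + (2M/r) ℓ ⊗ ℓ`, `ℓ = (1, x⃗/r)`. This file is the pointwise calculus of such
radial maps, for an arbitrary profile `(τ, ϱ)`:

* `hasFDerivAt_radialMap`, `fderiv_radialMap_apply` — the differential
  `DΦ(y) v = (τ′⟪y,v⟫/s) ∂_{t*} + ((ϱ′s − ϱ)⟪y,v⟫/s³)(0, y) + (ϱ/s)(0, v)`, `s = |y|`;
* `bilin_frame` — the Kerr–Schild form `g(P, Q)` on the radial frame `∂_{t*}, (0, y), (0, v)` in closed form
  (Visser arXiv:0706.0622 (32)–(34) at `a = 0`);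
* `bilin_tangent_tangent` — the induced form `g(DΦ v, DΦ w) = B⟪v,w⟫ + ((A − B)/s²)⟪y,v⟫⟪y,w⟫` with the
  RADIAL COEFFICIENT `A = −τ′² + ϱ′² + (2M/ϱ)(τ′ + ϱ′)²` and `B = (ϱ/s)²`;
* `bilin_rawNormal_tangent`, `bilin_rawNormal_self` — the raw normal `Ñ = g♯(ϱ′dt* − τ′dr)`,
  `Ñ = (−ϱ′ − (2M/ϱ)(ϱ′+τ′)) ∂_{t*} + ((−τ′ + (2M/ϱ)(ϱ′+τ′))/s)(0, y)`, is orthogonal to the tangent vectors and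
  has `g(Ñ, Ñ) = −A` (so `Φ` is spacelike exactly where `A > 0`, with unit normal `A^{-1/2} Ñ`);
* `spatial_radialMap`, `spatialNorm_radialMap`, `radialMap_mem_region` — the image lies in the chart.

References: O'Neill 1983, Ch. 4 (hypersurfaces), Ch. 5, Lemma 5.26; Visser arXiv:0706.0622, §5;
Dafermos–Rodnianski arXiv:0811.0354, §5.1.
-/

-- the doubled `FinalStateConjecture` path component is the summit/problem naming scheme, not a mistake
set_option linter.dupNamespace false

noncomputable section

open Real Set Filter
open scoped Manifold ContDiff Topology InnerProductSpace
open Literature.Geometry.Lorentzian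

namespace Summit.FinalStateConjecture.FinalStateConjecture.Theorems.SwallowTheDatum

namespace Bridge

section RadialMap

variable {τ ϱ : ℝ → ℝ} {t₁ r₁ : ℝ} {y : E3}

/-- The derivative of `y ↦ τ(‖y‖)` away from the origin: `v ↦ τ′(‖y‖) ‖y‖⁻¹ ⟪y, v⟫`. [folklore] -/
theorem hasFDerivAt_comp_norm (hy : y ≠ 0) (hτ : HasDerivAt τ t₁ ‖y‖) :
    HasFDerivAt (fun y : E3 ↦ τ ‖y‖) ((t₁ * ‖y‖⁻¹) • E3.covec y) y := by
  have h := hτ.comp_hasFDerivAt y (Kerr.hasFDerivAt_norm_E3 hy)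
  rw [smul_smul] at h
  exact h

/-- The derivative of `y ↦ ϱ(‖y‖)/‖y‖` away from the origin:
`v ↦ ((ϱ′(‖y‖) ‖y‖ − ϱ(‖y‖))/‖y‖³) ⟪y, v⟫`. [folklore] -/
theorem hasFDerivAt_comp_norm_div (hy : y ≠ 0) (hϱ : HasDerivAt ϱ r₁ ‖y‖) :
    HasFDerivAt (fun y : E3 ↦ ϱ ‖y‖ / ‖y‖)
      (((r₁ * ‖y‖ - ϱ ‖y‖) / ‖y‖ ^ 3) • E3.covec y) y := by
  have hs : ‖y‖ ≠ 0 := norm_ne_zero_iff.2 hy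
  have h1 := hasFDerivAt_comp_norm hy hϱ
  have h2 := Kerr.hasFDerivAt_inv_norm_pow hy 1
  have h := h1.mul h2
  have hfun : (fun y : E3 ↦ ϱ ‖y‖ / ‖y‖) = fun y ↦ ϱ ‖y‖ * (‖y‖ ^ 1)⁻¹ := by
    funext z; rw [pow_one, div_eq_mul_inv]
  rw [hfun]
  refine h.congr_fderiv ?_
  ext v
  simp only [add_apply, FunLike.coe_smul, Pi.smul_apply,
    E3.covec_apply, smul_eq_mul, pow_one]
  push_cast
  field_simp
  ring

/-- **The differential of the radial map** `Φ(y) = τ(‖y‖) ∂_{t*} + (ϱ(‖y‖)/‖y‖) (0, y)` away from the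
origin. [folklore] -/
theorem hasFDerivAt_radialMap (hy : y ≠ 0) (hτ : HasDerivAt τ t₁ ‖y‖) (hϱ : HasDerivAt ϱ r₁ ‖y‖) :
    HasFDerivAt (fun y : E3 ↦ τ ‖y‖ • E4.basisVector 0 + (ϱ ‖y‖ / ‖y‖) • E4.spaceEmbed y)
      (((t₁ * ‖y‖⁻¹) • E3.covec y).smulRight (E4.basisVector 0) +
        ((ϱ ‖y‖ / ‖y‖) • E4.spaceEmbed +
          (((r₁ * ‖y‖ - ϱ ‖y‖) / ‖y‖ ^ 3) • E3.covec y).smulRight (E4.spaceEmbed y))) y :=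
  ((hasFDerivAt_comp_norm hy hτ).smul_const (E4.basisVector 0)).add
    ((hasFDerivAt_comp_norm_div hy hϱ).smul E4.spaceEmbed.hasFDerivAt)

/-- The differential of the radial map on a vector:
`DΦ(y) v = (τ′ ⟪y,v⟫/‖y‖) ∂_{t*} + ((ϱ′‖y‖ − ϱ) ⟪y,v⟫/‖y‖³) (0, y) + (ϱ/‖y‖) (0, v)`. [folklore] -/
theorem fderiv_radialMap_apply (hy : y ≠ 0) (hτ : HasDerivAt τ t₁ ‖y‖) (hϱ : HasDerivAt ϱ r₁ ‖y‖)
    (v : E3) :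
    fderiv ℝ (fun y : E3 ↦ τ ‖y‖ • E4.basisVector 0 + (ϱ ‖y‖ / ‖y‖) • E4.spaceEmbed y) y v =
      (t₁ * ‖y‖⁻¹ * ⟪y, v⟫_ℝ) • E4.basisVector 0 +
        ((r₁ * ‖y‖ - ϱ ‖y‖) / ‖y‖ ^ 3 * ⟪y, v⟫_ℝ) • E4.spaceEmbed y +
          (ϱ ‖y‖ / ‖y‖) • E4.spaceEmbed v := by
  rw [(hasFDerivAt_radialMap hy hτ hϱ).fderiv]
  simp only [add_apply, ContinuousLinearMap.smulRight_apply,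
    FunLike.coe_smul, Pi.smul_apply, E3.covec_apply, smul_eq_mul]
  abel

end RadialMap

section Frame

/-- Time component of a vector of the radial frame `p₀ ∂_{t*} + p₁ (0, y) + p₂ (0, v)`. [folklore] -/
theorem frame_apply_zero (p₀ p₁ p₂ : ℝ) (y v : E3) :
    (p₀ • E4.basisVector 0 + p₁ • E4.spaceEmbed y + p₂ • E4.spaceEmbed v) 0 = p₀ := by
  simp

/-- Spatial part of a vector of the radial frame. [folklore] -/
theorem spatial_frame (p₀ p₁ p₂ : ℝ) (y v : E3) :
    E4.spatial (p₀ • E4.basisVector 0 + p₁ • E4.spaceEmbed y + p₂ • E4.spaceEmbed v) = p₁ • y + p₂ • v := by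
  simp

/-- **The Schwarzschild Kerr–Schild form on the radial frame.** At a point `x` whose spatial part is
`κ y` (`κ > 0`, `y ≠ 0`, so `r = κ‖y‖`), for `P = p₀ ∂_{t*} + p₁ (0,y) + p₂ (0,v)` and
`Q = q₀ ∂_{t*} + q₁ (0,y) + q₂ (0,w)`:
`g(P, Q) = −p₀q₀ + ⟪P⃗, Q⃗⟫ + (2M/r)(p₀ + ⟪ŷ, P⃗⟫)(q₀ + ⟪ŷ, Q⃗⟫)` in closed form.
[cite: arXiv07060622, (32)–(34)] -/
theorem bilin_frame (M : ℝ) {x : E4} {y : E3} {κ : ℝ} (hκ : 0 < κ) (hy : y ≠ 0)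
    (hx : E4.spatial x = κ • y) (p₀ p₁ p₂ q₀ q₁ q₂ : ℝ) (v w : E3) :
    Kerr.bilin M 0 x (p₀ • E4.basisVector 0 + p₁ • E4.spaceEmbed y + p₂ • E4.spaceEmbed v)
        (q₀ • E4.basisVector 0 + q₁ • E4.spaceEmbed y + q₂ • E4.spaceEmbed w) =
      -(p₀ * q₀) + (p₁ * q₁ * ‖y‖ ^ 2 + p₁ * q₂ * ⟪y, w⟫_ℝ + p₂ * q₁ * ⟪y, v⟫_ℝ + p₂ * q₂ * ⟪v, w⟫_ℝ) +
        2 * M / (κ * ‖y‖) *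
          ((p₀ + (p₁ * ‖y‖ ^ 2 + p₂ * ⟪y, v⟫_ℝ) / ‖y‖) * (q₀ + (q₁ * ‖y‖ ^ 2 + q₂ * ⟪y, w⟫_ℝ) / ‖y‖)) := by
  have hs : ‖y‖ ≠ 0 := norm_ne_zero_iff.2 hy
  have hxn : E4.spatialNorm x = κ * ‖y‖ := by
    rw [E4.spatialNorm, hx, norm_smul, Real.norm_of_nonneg hκ.le]
  have hxn0 : E4.spatialNorm x ≠ 0 := by rw [hxn]; positivity
  rw [Kerr.bilin_zero_spin_apply M hxn0, hxn, frame_apply_zero, frame_apply_zero, spatial_frame, spatial_frame, hx]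
  simp only [inner_add_left, inner_add_right, inner_smul_left, inner_smul_right, conj_trivial,
    real_inner_self_eq_norm_sq, real_inner_comm v y, real_inner_comm w y, real_inner_comm w v]
  field_simp
  ring

end Frame

section Induced

variable (M : ℝ) {x : E4} {y : E3} {t₁ r r₁ : ℝ}

/-- **The induced form of a radial immersion.** With `DΦ v = (τ′a/s) ∂_{t*} + ((ϱ′s − ϱ)a/s³)(0,y) + (ϱ/s)(0,v)`
(`a = ⟪y, v⟫`, `s = ‖y‖`) at a point with spatial part `(ϱ/s) y`, `ϱ > 0`:
`g(DΦ v, DΦ w) = B ⟪v, w⟫ + ((A − B)/s²) ⟪y, v⟫⟪y, w⟫`, `A = −τ′² + ϱ′² + (2M/ϱ)(τ′ + ϱ′)²` (radial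
coefficient), `B = (ϱ/s)²` (tangential coefficient). [cite: arXiv07060622, (32)–(34)] -/
theorem bilin_tangent_tangent (hr : 0 < r) (hy : y ≠ 0) (hx : E4.spatial x = (r / ‖y‖) • y) (v w : E3) :
    Kerr.bilin M 0 x
        ((t₁ * ‖y‖⁻¹ * ⟪y, v⟫_ℝ) • E4.basisVector 0 +
          ((r₁ * ‖y‖ - r) / ‖y‖ ^ 3 * ⟪y, v⟫_ℝ) • E4.spaceEmbed y + (r / ‖y‖) • E4.spaceEmbed v)
        ((t₁ * ‖y‖⁻¹ * ⟪y, w⟫_ℝ) • E4.basisVector 0 +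
          ((r₁ * ‖y‖ - r) / ‖y‖ ^ 3 * ⟪y, w⟫_ℝ) • E4.spaceEmbed y + (r / ‖y‖) • E4.spaceEmbed w) =
      (r / ‖y‖) ^ 2 * ⟪v, w⟫_ℝ +
        ((-t₁ ^ 2 + r₁ ^ 2 + 2 * M / r * (t₁ + r₁) ^ 2) - (r / ‖y‖) ^ 2) / ‖y‖ ^ 2 *
          (⟪y, v⟫_ℝ * ⟪y, w⟫_ℝ) := by
  have hs : ‖y‖ ≠ 0 := norm_ne_zero_iff.2 hy
  have hκ : 0 < r / ‖y‖ := div_pos hr (norm_pos_iff.2 hy)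
  rw [bilin_frame M hκ hy hx]
  field_simp
  ring

/-- **The raw normal is normal**: `Ñ = n₀ ∂_{t*} + (n₁/s)(0, y)` with `n₀ = −ϱ′ − (2M/ϱ)(ϱ′ + τ′)`,
`n₁ = −τ′ + (2M/ϱ)(ϱ′ + τ′)` (the vector `g♯(ϱ′ dt* − τ′ dr)`) is `g`-orthogonal to every `DΦ w`.
[cite: ONeill1983, Ch. 4, p. 98] -/
theorem bilin_rawNormal_tangent (hr : 0 < r) (hy : y ≠ 0) (hx : E4.spatial x = (r / ‖y‖) • y) (v w : E3) :
    Kerr.bilin M 0 x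
        ((-r₁ - 2 * M / r * (r₁ + t₁)) • E4.basisVector 0 +
          ((-t₁ + 2 * M / r * (r₁ + t₁)) / ‖y‖) • E4.spaceEmbed y + (0 : ℝ) • E4.spaceEmbed v)
        ((t₁ * ‖y‖⁻¹ * ⟪y, w⟫_ℝ) • E4.basisVector 0 +
          ((r₁ * ‖y‖ - r) / ‖y‖ ^ 3 * ⟪y, w⟫_ℝ) • E4.spaceEmbed y + (r / ‖y‖) • E4.spaceEmbed w) = 0 := by
  have hs : ‖y‖ ≠ 0 := norm_ne_zero_iff.2 hy
  have hκ : 0 < r / ‖y‖ := div_pos hr (norm_pos_iff.2 hy)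
  rw [bilin_frame M hκ hy hx]
  field_simp
  ring

/-- **The raw normal has square `−A`**: `g(Ñ, Ñ) = −(−τ′² + ϱ′² + (2M/ϱ)(τ′ + ϱ′)²)`, so the immersion is
spacelike exactly where `A > 0`, with unit normal `A^{-1/2} Ñ`. [cite: ONeill1983, Ch. 5, Lemma 5.26] -/
theorem bilin_rawNormal_self (hr : 0 < r) (hy : y ≠ 0) (hx : E4.spatial x = (r / ‖y‖) • y) (v : E3) :
    Kerr.bilin M 0 x
        ((-r₁ - 2 * M / r * (r₁ + t₁)) • E4.basisVector 0 +
          ((-t₁ + 2 * M / r * (r₁ + t₁)) / ‖y‖) • E4.spaceEmbed y + (0 : ℝ) • E4.spaceEmbed v)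
        ((-r₁ - 2 * M / r * (r₁ + t₁)) • E4.basisVector 0 +
          ((-t₁ + 2 * M / r * (r₁ + t₁)) / ‖y‖) • E4.spaceEmbed y + (0 : ℝ) • E4.spaceEmbed v) =
      -(-t₁ ^ 2 + r₁ ^ 2 + 2 * M / r * (t₁ + r₁) ^ 2) := by
  have hs : ‖y‖ ≠ 0 := norm_ne_zero_iff.2 hy
  have hκ : 0 < r / ‖y‖ := div_pos hr (norm_pos_iff.2 hy)
  rw [bilin_frame M hκ hy hx]
  field_simp
  ring

end Induced


section Point

variable {r₀ : ℝ} {τ ϱ : ℝ → ℝ} {Φ : E3 → E4}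

/-- The spatial part of a point of the radial map is `(ϱ/s) y`. [folklore] -/
theorem spatial_radialMap (hΦ : ∀ y, Φ y = τ ‖y‖ • E4.basisVector 0 + (ϱ ‖y‖ / ‖y‖) • E4.spaceEmbed y)
    (y : E3) : E4.spatial (Φ y) = (ϱ ‖y‖ / ‖y‖) • y := by
  rw [hΦ]
  simp

/-- The spatial radius of a point of the radial map is `ϱ(‖y‖)` (for `ϱ > 0`). [folklore] -/
theorem spatialNorm_radialMap (hΦ : ∀ y, Φ y = τ ‖y‖ • E4.basisVector 0 + (ϱ ‖y‖ / ‖y‖) • E4.spaceEmbed y)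
    {y : E3} (hy : y ≠ 0) (hpos : 0 < ϱ ‖y‖) : E4.spatialNorm (Φ y) = ϱ ‖y‖ := by
  have hs : ‖y‖ ≠ 0 := norm_ne_zero_iff.2 hy
  rw [E4.spatialNorm, spatial_radialMap hΦ, norm_smul, Real.norm_of_nonneg (div_pos hpos (norm_pos_iff.2 hy)).le]
  field_simp

/-- A point of the radial map with `ϱ(‖y‖) > max r₀ 0` lies in the chart domain `Kerr.region 0 r₀`. [folklore] -/
theorem radialMap_mem_region (hΦ : ∀ y, Φ y = τ ‖y‖ • E4.basisVector 0 + (ϱ ‖y‖ / ‖y‖) • E4.spaceEmbed y)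
    {y : E3} (hy : y ≠ 0) (hr₀ : max r₀ 0 < ϱ ‖y‖) : Φ y ∈ Kerr.region 0 r₀ := by
  rw [Kerr.mem_region, Kerr.radius_zero_left, spatialNorm_radialMap hΦ hy ((le_max_right _ _).trans_lt hr₀)]
  exact hr₀

end Point

end Bridge

/-- **Registered export of this file** (sub-goal `bridge_inducedForm` of stub `stub_bridgeAnnulus`): the induced form of a radial map, `Bridge.bilin_tangent_tangent`. [cite: arXiv07060622, (32)–(34)] -/
theorem bridge_inducedForm :
    ∀ (M : ℝ) (x : E4) (y : E3) (t₁ r r₁ : ℝ), 0 < r → y ≠ 0 → E4.spatial x = (r / ‖y‖) • y → ∀ (v w : E3), Kerr.bilin M 0 x ((t₁ * ‖y‖⁻¹ * ⟪y, v⟫_ℝ) • E4.basisVector 0 + ((r₁ * ‖y‖ - r) / ‖y‖ ^ 3 * ⟪y, v⟫_ℝ) • E4.spaceEmbed y + (r / ‖y‖) • E4.spaceEmbed v) ((t₁ * ‖y‖⁻¹ * ⟪y, w⟫_ℝ) • E4.basisVector 0 + ((r₁ * ‖y‖ - r) / ‖y‖ ^ 3 * ⟪y, w⟫_ℝ) •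 E4.spaceEmbed y + (r / ‖y‖) • E4.spaceEmbed w) = (r / ‖y‖) ^ 2 * ⟪v, w⟫_ℝ + ((-t₁ ^ 2 + r₁ ^ 2 + 2 * M / r * (t₁ + r₁) ^ 2) - (r / ‖y‖) ^ 2) / ‖y‖ ^ 2 * (⟪y, v⟫_ℝ * ⟪y, w⟫_ℝ) :=
  fun M _ _ _ _ _ hr hy hx v w ↦ Bridge.bilin_tangent_tangent M hr hy hx v w

end Summit.FinalStateConjecture.FinalStateConjecture.Theorems.SwallowTheDatum

end
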